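import Summits.CriticalPhenomena.PercolationContinuityZ3.Theorems.PercNearOneGluingNoHeavyLowerTailStarSetTwoPortLevelTwo
import Summits.CriticalPhenomena.PercolationContinuityZ3.Theorems.PercNearOneGluingNoHeavyLowerTailStarSetPendantForest
import HarnessLib

/-!
# `NoHeavyLowerTail` (stmt-CriticalPhenomena-4575) — EVERY two-port star multigraph at level `j ≤ 2`: champion at a port, observer corollary

Support file (prover `prim-gen-swap` gen 16; `--supports stmt-CriticalPhenomena-4575`).  No definitions, no named facts, no sorries.

`StarSet.setCS_twoPortStarMultigraph_levelTwo` (…StarSetTwoPortLevelTwo, gen 15) proves the observer-set inequality `CS_w(S, c)` at level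
`j ≤ 2` for an ARBITRARY system of two-port pendant stars (any port multigraph: parallel stars, triangles, cycles), for `c ∈ A` OFF the
ports dominating them.  As in …StarSetForestChampion / …StarSetClassForestChampion (the forest and class-forest cases), this file removes
the restriction "`c` off the ports" for a CHAMPION `c` and derives the observer corollary — now with NO hypothesis on the port multigraph:

* `StarSet.setCS_twoPortStarMultigraph_levelTwo_champion` — `c` a champion of `A` (a port or not); induction on the number of stars (a star
  containing the champion is stripped: pivot on the pair `c–y₀` (`stub_oneBondDecomp_k15`; glued: both events null), delete it
  (`CutObserver.champion_of_erase_own_edge`), strip the now relay-pendant `y₀` (`CutObserver.setCS_of_pendantMember`, lightnesses off `y₀` by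
  `Hyperedge.lightness_eq_of_sameGlue`), and apply the induction hypothesis to the remaining stars re-indexed by `Fin.succAbove`).
* `StarSet.cil_twoPortStarMultigraph_levelTwo_champion` — **CIL_j (`j ≤ 2`, all `|A|`) at an observer `o ∉ A` whose positive-weight
  non-relay neighbours are among two-port pendant stars (ANY port multigraph), witness ANY `H`-champion `q ∈ A`** (`cil_of_starStability`).
-/

noncomputable section

namespace Summit.CriticalPhenomena.PercolationContinuityZ3.Theorems

open MeasureTheory Set Literature.Probability.LatticeModels Literature.Probability.Percolation
open scoped Classical BigOperators

variable {n : ℕ}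

namespace StarSet

open CutObserver KNPreFKG Hyperedge in
/-- **OES for EVERY two-port star multigraph at level `j ≤ 2`, champion witness (port or not).**  Stars `s i ∉ A` (pairwise distinct) with
ports `p i ≠ p' i ∈ A`, no other positive pair (the port multigraph `{p i, p' i}_i` is arbitrary); `c` a champion of `A`.  Then
`μ(c ↮ S, 1 ≤ |π(S)| ≤ j) ≤ μ(c ↮ S, |π(c)| ≤ j)`, `S = {s i}`. [cite: VandenbergHaggstromKahn2005, Thm. 1.5 (p. 7)] -/
theorem setCS_twoPortStarMultigraph_levelTwo_champion (A : Finset (Fin n)) (c : Fin n) (j : ℕ) (hj : j ≤ 2) (hcA : c ∈ A) :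
    ∀ (m : ℕ) (w : Sym2 (Fin n) → unitInterval) (s p p' : Fin m → Fin n),
      Function.Injective s → (∀ i, s i ∉ A) → (∀ i, p i ∈ A) → (∀ i, p' i ∈ A) → (∀ i, p i ≠ p' i) →
      (∀ i (u : Fin n), u ≠ s i → u ≠ p i → u ≠ p' i → w s(s i, u) = 0) →
      (∀ a ∈ A, (prodBernoulli w).real {ω : BondConfig (Fin n) | (A.filter fun z => ω ∈ openConn a z).card ≤ j} ≤
        (prodBernoulli w).real {ω : BondConfig (Fin n) | (A.filter fun z => ω ∈ openConn c z).card ≤ j}) →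
      (prodBernoulli w).real {ω : BondConfig (Fin n) | (∀ x ∈ Finset.univ.image s, ω ∉ openConn c x) ∧
          1 ≤ (A.filter fun z => ∃ x ∈ Finset.univ.image s, ω ∈ openConn x z).card ∧
          (A.filter fun z => ∃ x ∈ Finset.univ.image s, ω ∈ openConn x z).card ≤ j} ≤
        (prodBernoulli w).real {ω : BondConfig (Fin n) | (∀ x ∈ Finset.univ.image s, ω ∉ openConn c x) ∧
          (A.filter fun z => ω ∈ openConn c z).card ≤ j} := by
  haveI : ∀ u : Sym2 (Fin n) → unitInterval, IsProbabilityMeasure (prodBernoulli u) := fun u => inferInstance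
  intro m
  induction m with
  | zero =>
    intro w s p p' hs hsA hpA hp'A hpp' hobs hchamp
    exact setCS_twoPortStarMultigraph_levelTwo w A s p p' c j hj hs hsA hpA hp'A hpp' hcA (fun i => Fin.elim0 i) hobs
      (fun i => Fin.elim0 i)
  | succ m ih =>
    intro w s p p' hs hsA hpA hp'A hpp' hobs hchamp
    by_cases hport : ∀ i, c ≠ p i ∧ c ≠ p' i
    · exact setCS_twoPortStarMultigraph_levelTwo w A s p p' c j hj hs hsA hpA hp'A hpp' hcA hport hobs
        (fun i => ⟨hchamp _ (hpA i), hchamp _ (hp'A i)⟩)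
    push Not at hport
    obtain ⟨i₀, hi₀⟩ := hport
    have hc : c = p i₀ ∨ c = p' i₀ := by
      by_cases h : c = p i₀
      · exact Or.inl h
      · exact Or.inr (hi₀ h)
    -- the star `y₀ = s i₀`, its other port `z`
    set y₀ : Fin n := s i₀ with hy₀def
    set B : Finset (Fin n) := Finset.univ.image s with hB
    have hy₀B : y₀ ∈ B := Finset.mem_image_of_mem s (Finset.mem_univ i₀)
    obtain ⟨z, hzdef⟩ : ∃ z, (c = p i₀ ∧ z = p' i₀) ∨ (c = p' i₀ ∧ z = p i₀) := by
      rcases hc with h | h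
      · exact ⟨p' i₀, Or.inl ⟨h, rfl⟩⟩
      · exact ⟨p i₀, Or.inr ⟨h, rfl⟩⟩
    have hzA : z ∈ A := by
      rcases hzdef with ⟨-, rfl⟩ | ⟨-, rfl⟩
      · exact hp'A i₀
      · exact hpA i₀
    have hcz : c ≠ z := by
      rcases hzdef with ⟨rfl, rfl⟩ | ⟨rfl, rfl⟩
      · exact hpp' i₀
      · exact (hpp' i₀).symm
    have hport_iff : ∀ u, (u = p i₀ ∨ u = p' i₀) ↔ (u = c ∨ u = z) := by
      intro u
      rcases hzdef with ⟨h1, h2⟩ | ⟨h1, h2⟩ <;> rw [h1, h2]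
      exact or_comm
    have hy₀A : y₀ ∉ A := hsA i₀
    have hcy : c ≠ y₀ := fun h => hy₀A (h ▸ hcA)
    have hzy : z ≠ y₀ := fun h => hy₀A (h ▸ hzA)
    set e : Sym2 (Fin n) := s(c, y₀) with he
    have hee : s(y₀, c) = e := Sym2.eq_swap
    set LS := {ω : BondConfig (Fin n) | (∀ x ∈ B, ω ∉ openConn c x) ∧
      1 ≤ (A.filter fun z => ∃ x ∈ B, ω ∈ openConn x z).card ∧
      (A.filter fun z => ∃ x ∈ B, ω ∈ openConn x z).card ≤ j} with hLS
    set RS := {ω : BondConfig (Fin n) | (∀ x ∈ B, ω ∉ openConn c x) ∧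
      (A.filter fun z => ω ∈ openConn c z).card ≤ j} with hRS
    -- both events force the pair `c–y₀` closed
    have hsub : ∀ ω : BondConfig (Fin n), (∀ x ∈ B, ω ∉ openConn c x) → e ∉ ω := by
      intro ω h hopen
      have hadj : (openGraph ω).Adj c y₀ := by rw [openGraph, SimpleGraph.fromEdgeSet_adj]; exact ⟨hopen, hcy⟩
      exact h y₀ hy₀B hadj.reachable
    have hnull : ∀ S : Set (BondConfig (Fin n)), (∀ ω ∈ S, e ∉ ω) →
        (prodBernoulli (Function.update w e 1)).real S = 0 := by
      intro S hS
      refine le_antisymm ?_ measureReal_nonneg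
      calc (prodBernoulli (Function.update w e 1)).real S
          ≤ (prodBernoulli (Function.update w e 1)).real {ω : BondConfig (Fin n) | e ∉ ω} :=
            measureReal_mono (fun ω hω => hS ω hω) (measure_ne_top _ _)
        _ = 0 := by rw [prodBernoulli_real_setOf_notMem, Function.update_self]; simp
    have hL1 : (prodBernoulli (Function.update w e 1)).real LS = 0 := hnull LS fun ω hω => hsub ω hω.1
    have hR1 : (prodBernoulli (Function.update w e 1)).real RS = 0 := hnull RS fun ω hω => hsub ω hω.1
    have hdecL := stub_oneBondDecomp_k15 n w e LS
    have hdecR := stub_oneBondDecomp_k15 n w e RS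
    rw [hL1] at hdecL
    rw [hR1] at hdecR
    set w₀ : Sym2 (Fin n) → unitInterval := Function.update w e 0 with hw₀
    have hy0 : 0 ≤ 1 - (w e : ℝ) := sub_nonneg.2 (w e).2.2
    by_cases hy1 : (w e : ℝ) < 1
    swap
    · have hwe : (w e : ℝ) = 1 := le_antisymm (w e).2.2 (not_lt.1 hy1)
      rw [hdecL, hwe]
      have : 0 ≤ (prodBernoulli w).real RS := measureReal_nonneg
      linarith
    suffices h0 : (prodBernoulli w₀).real LS ≤ (prodBernoulli w₀).real RS by
      rw [hdecL, hdecR]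
      have := mul_le_mul_of_nonneg_left h0 hy0
      linarith
    have hw₀e : w₀ e = 0 := by rw [hw₀, Function.update_self]
    have hw₀_ne : ∀ f : Sym2 (Fin n), f ≠ e → w₀ f = w f := fun f hf => by rw [hw₀, Function.update_of_ne hf]
    have hchamp₀ := champion_of_erase_own_edge w A c y₀ j hcy hy1 hchamp
    have hobs₀ : ∀ u, u ≠ y₀ → w₀ s(y₀, u) ≠ 0 → u = c ∨ u = z := by
      intro u hu h
      by_cases huc : u = c
      · exact Or.inl huc
      rw [hw₀_ne _ (fun h' => huc (by rw [← hee] at h'; exact Sym2.congr_right.1 h'))] at h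
      refine (hport_iff u).1 ?_
      by_contra hnot
      rw [not_or] at hnot
      exact h (hobs i₀ u hu hnot.1 hnot.2)
    have hiso : ∀ u, u ≠ y₀ → u ≠ z → w₀ s(y₀, u) = 0 := by
      intro u hu huz
      by_contra h
      rcases hobs₀ u hu h with rfl | rfl
      · rw [hee] at h; exact h hw₀e
      · exact huz rfl
    set w₀' : Sym2 (Fin n) → unitInterval := fun f => if f ∈ {f : Sym2 (Fin n) | y₀ ∉ f} then w₀ f else 0 with hw₀'
    have hw₀'z : ∀ u, w₀' s(y₀, u) = 0 := by
      intro u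
      have : ¬ (y₀ ∉ s(y₀, u)) := fun h => h (Sym2.mem_mk_left _ _)
      simp only [hw₀', mem_setOf_eq, this, if_false]
    have hobs₀' : ∀ u, u ≠ y₀ → w₀' s(y₀, u) ≠ 0 → u = c ∨ u = z := fun u _ h => absurd (hw₀'z u) h
    have hoff' : ∀ f : Sym2 (Fin n), y₀ ∉ f → w₀ f = w₀' f := by
      intro f hf; simp only [hw₀', mem_setOf_eq, hf, not_false_eq_true, if_true]
    have hglue' : (w₀ s(y₀, c) : ℝ) * w₀ s(y₀, z) = (w₀' s(y₀, c) : ℝ) * w₀' s(y₀, z) := by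
      rw [hw₀'z c, hw₀'z z, hee, hw₀e]; simp
    have hsame : ∀ x ∈ A, (prodBernoulli w₀).real {ω : BondConfig (Fin n) | (A.filter fun a => ω ∈ openConn x a).card ≤ j} =
        (prodBernoulli w₀').real {ω : BondConfig (Fin n) | (A.filter fun a => ω ∈ openConn x a).card ≤ j} :=
      fun x hx => lightness_eq_of_sameGlue w₀ w₀' A y₀ c z x j hy₀A hx hcy hzy hcz hobs₀ hobs₀' hoff' hglue'
    have hdom' : ∀ x ∈ A, (prodBernoulli w₀').real {ω : BondConfig (Fin n) | (A.filter fun a => ω ∈ openConn x a).card ≤ j} ≤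
        (prodBernoulli w₀').real {ω : BondConfig (Fin n) | (A.filter fun a => ω ∈ openConn c a).card ≤ j} := by
      intro x hx
      rw [← hsame x hx, ← hsame c hcA]; exact hchamp₀ x hx
    have hw₀'_off : ∀ y u : Fin n, y ≠ y₀ → u ≠ y₀ → w₀' s(y, u) = w s(y, u) := by
      intro y u hy hu
      have hf : y₀ ∉ s(y, u) := by
        intro h
        rcases Sym2.mem_iff.1 h with h | h
        · exact hy h.symm
        · exact hu h.symm
      rw [← hoff' _ hf, hw₀_ne _ (fun h => hf (by rw [h]; exact Sym2.mem_mk_right c y₀))]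
    -- the remaining stars, re-indexed by `Fin m`
    set s₁ : Fin m → Fin n := fun k => s (Fin.succAbove i₀ k) with hs₁
    have hs₁inj : Function.Injective s₁ := fun k k' h => Fin.succAbove_right_injective (hs h)
    have hB₁ : Finset.univ.image s₁ = B.erase y₀ := by
      ext y
      rw [Finset.mem_image, Finset.mem_erase, hB, Finset.mem_image]
      constructor
      · rintro ⟨k, -, rfl⟩
        exact ⟨fun h => Fin.succAbove_ne i₀ k (hs h), Fin.succAbove i₀ k, Finset.mem_univ _, rfl⟩
      · rintro ⟨hne, i, -, rfl⟩
        have hii₀ : i ≠ i₀ := fun h => hne (by rw [h])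
        obtain ⟨k, hk⟩ := Fin.exists_succAbove_eq hii₀
        exact ⟨k, Finset.mem_univ _, by simp only [hs₁, hk]⟩
    have hrest₁ := ih w₀' s₁ (fun k => p (Fin.succAbove i₀ k)) (fun k => p' (Fin.succAbove i₀ k)) hs₁inj (fun k => hsA _)
      (fun k => hpA _) (fun k => hp'A _) (fun k => hpp' _)
      (fun k u hu hup hup' => by
        have hk : s₁ k ≠ y₀ := fun h => Fin.succAbove_ne i₀ k (hs h)
        by_cases huy : u = y₀
        · rw [huy, Sym2.eq_swap]; exact hw₀'z _
        · rw [hw₀'_off _ u hk huy]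
          exact hobs (Fin.succAbove i₀ k) u hu hup hup')
      hdom'
    rw [hB₁] at hrest₁
    have hdomz : (prodBernoulli w₀').real {ω : BondConfig (Fin n) | (A.filter fun a => ω ∈ openConn z a).card ≤ j} ≤
        (prodBernoulli w₀').real {ω : BondConfig (Fin n) | (A.filter fun a => ω ∈ openConn c a).card ≤ j} := hdom' z hzA
    exact setCS_of_pendantMember w₀ A B c y₀ z j hy₀B hy₀A hzy hcy hiso hdomz hrest₁

open CutObserver in
/-- **CIL at level `j ≤ 2` for an observer whose Steiner neighbours are two-port pendant stars — ANY port multigraph** (any number of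
stars, parallel stars / triangles / cycles allowed, any relay neighbours, all `|A|`), witness ANY `H`-champion `q ∈ A`:
`μ(1 ≤ |π(o)| ≤ j) ≤ μ(|π(q)| ≤ j)`.
[cite: VandenbergHaggstromKahn2005, Thm. 1.5 (p. 7); KozmaNitzan2024, Thm. 4 (pp. 13–14) — star transfer `cil_of_starStability`] -/
theorem cil_twoPortStarMultigraph_levelTwo_champion {Ms : ℕ} (w : Sym2 (Fin n) → unitInterval) (A : Finset (Fin n)) (o q : Fin n)
    (s p p' : Fin Ms → Fin n) (j : ℕ) (hj : j ≤ 2) (hoA : o ∉ A) (hqA : q ∈ A)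
    (hs : Function.Injective s) (hso : ∀ i, s i ≠ o) (hsA : ∀ i, s i ∉ A) (hpA : ∀ i, p i ∈ A) (hp'A : ∀ i, p' i ∈ A)
    (hpp' : ∀ i, p i ≠ p' i)
    (hnbr : ∀ y : Fin n, y ≠ o → y ∉ A → w s(o, y) ≠ 0 → ∃ i, y = s i)
    (hobs : ∀ i (u : Fin n), u ≠ s i → u ≠ o → u ≠ p i → u ≠ p' i → w s(s i, u) = 0)
    (hchamp : ∀ a ∈ A,
      (prodBernoulli w).real {ω : BondConfig (Fin n) |
          (A.filter fun z => (openGraph (ω ∩ {e | o ∉ e})).Reachable a z).card ≤ j} ≤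
        (prodBernoulli w).real {ω : BondConfig (Fin n) |
          (A.filter fun z => (openGraph (ω ∩ {e | o ∉ e})).Reachable q z).card ≤ j}) :
    (prodBernoulli w).real {ω : BondConfig (Fin n) |
        1 ≤ (A.filter fun x => ω ∈ openConn o x).card ∧ (A.filter fun x => ω ∈ openConn o x).card ≤ j} ≤
      (prodBernoulli w).real {ω : BondConfig (Fin n) | (A.filter fun x => ω ∈ openConn q x).card ≤ j} := by
  have hqo : q ≠ o := fun h => hoA (h ▸ hqA)
  refine cil_of_starStability w A o q j hoA hqo fun B hBne hB => ?_
  set u : Sym2 (Fin n) → unitInterval := fun e => if e ∈ {e : Sym2 (Fin n) | o ∉ e} then w e else 0 with hu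
  have hmem : ∀ y ∈ B, y ≠ o ∧ y ∉ A ∧ w s(o, y) ≠ 0 := by
    intro y hy
    obtain ⟨hyo, hwy, hlt⟩ := hB y hy
    refine ⟨hyo, fun hyA => ?_, hwy⟩
    exact absurd (hchamp y hyA) (not_le.2 hlt)
  have e1 : ∀ x : Fin n, {ω : BondConfig (Fin n) |
        (A.filter fun z => (openGraph (ω ∩ {e | o ∉ e})).Reachable x z).card ≤ j} =
      {ω : BondConfig (Fin n) | ω ∩ {e | o ∉ e} ∈
        {ξ : BondConfig (Fin n) | (A.filter fun z => ξ ∈ openConn x z).card ≤ j}} := by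
    intro x; ext ω; simp only [mem_setOf_eq, filter_avoid_eq]
  have hdomH : ∀ x ∈ A, (prodBernoulli u).real {ξ : BondConfig (Fin n) | (A.filter fun z => ξ ∈ openConn x z).card ≤ j} ≤
      (prodBernoulli u).real {ξ : BondConfig (Fin n) | (A.filter fun z => ξ ∈ openConn q z).card ≤ j} := by
    intro x hx
    have h := hchamp x hx
    rw [e1 x, e1 q, measureReal_preimage_avoid, measureReal_preimage_avoid] at h
    exact h
  have e2 : {ω : BondConfig (Fin n) |
        (∀ y ∈ B, ¬ (openGraph (ω ∩ {e | o ∉ e})).Reachable q y) ∧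
          1 ≤ (A.filter fun z => ∃ y ∈ B, (openGraph (ω ∩ {e | o ∉ e})).Reachable y z).card ∧
          (A.filter fun z => ∃ y ∈ B, (openGraph (ω ∩ {e | o ∉ e})).Reachable y z).card ≤ j} =
      {ω : BondConfig (Fin n) | ω ∩ {e | o ∉ e} ∈
        {ξ : BondConfig (Fin n) | (∀ x ∈ B, ξ ∉ openConn q x) ∧
          1 ≤ (A.filter fun z => ∃ x ∈ B, ξ ∈ openConn x z).card ∧
          (A.filter fun z => ∃ x ∈ B, ξ ∈ openConn x z).card ≤ j}} := by
    ext ω; simp only [mem_setOf_eq, filter_avoid_exists_eq]; exact Iff.rfl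
  have e3 : {ω : BondConfig (Fin n) |
        (∀ y ∈ B, ¬ (openGraph (ω ∩ {e | o ∉ e})).Reachable q y) ∧
          (A.filter fun z => (openGraph (ω ∩ {e | o ∉ e})).Reachable q z).card ≤ j} =
      {ω : BondConfig (Fin n) | ω ∩ {e | o ∉ e} ∈
        {ξ : BondConfig (Fin n) | (∀ x ∈ B, ξ ∉ openConn q x) ∧
          (A.filter fun z => ξ ∈ openConn q z).card ≤ j}} := by
    ext ω; simp only [mem_setOf_eq, filter_avoid_eq]; exact Iff.rfl
  rw [e2, e3, measureReal_preimage_avoid, measureReal_preimage_avoid]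
  have hu_oy : ∀ y v : Fin n, v = o → u s(y, v) = 0 := by
    intro y v hv
    simp only [hu, mem_setOf_eq]
    rw [if_neg (fun h => h (hv ▸ Sym2.mem_mk_right y v))]
  have hu_off : ∀ y v : Fin n, y ≠ o → v ≠ o → u s(y, v) = w s(y, v) := by
    intro y v hy hv
    simp only [hu, mem_setOf_eq]
    rw [if_pos]
    intro h
    rcases Sym2.mem_iff.1 h with h | h
    · exact hy h.symm
    · exact hv h.symm
  -- the stars in `B`
  set I : Finset (Fin Ms) := Finset.univ.filter fun i => s i ∈ B with hI
  set emb := I.orderEmbOfFin rfl with hemb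
  set s' : Fin I.card → Fin n := fun k => s (emb k) with hs'
  have hembI : ∀ k, emb k ∈ I := fun k => Finset.orderEmbOfFin_mem I rfl k
  have hs'B : ∀ k, s' k ∈ B := fun k => (Finset.mem_filter.1 (hembI k)).2
  have hs'inj : Function.Injective s' := fun k k' h => emb.injective (hs h)
  have hSB : Finset.univ.image s' = B := by
    ext y
    rw [Finset.mem_image]
    constructor
    · rintro ⟨k, -, rfl⟩; exact hs'B k
    · intro hy
      obtain ⟨hyo, hyA, hwy⟩ := hmem y hy
      obtain ⟨i, rfl⟩ := hnbr y hyo hyA hwy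
      have hiI : i ∈ I := Finset.mem_filter.2 ⟨Finset.mem_univ _, hy⟩
      have hrange := Finset.range_orderEmbOfFin I rfl
      have hi' : i ∈ Set.range emb := by rw [hemb, hrange]; exact hiI
      obtain ⟨k, hk⟩ := hi'
      exact ⟨k, Finset.mem_univ _, by simp only [hs', hk]⟩
  have h := setCS_twoPortStarMultigraph_levelTwo_champion A q j hj hqA I.card u s' (fun k => p (emb k))
    (fun k => p' (emb k)) hs'inj (fun k => hsA _) (fun k => hpA _) (fun k => hp'A _) (fun k => hpp' _)
    (fun k v hv hvp hvp' => by
      by_cases hvo : v = o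
      · exact hu_oy _ v hvo
      · rw [hs', hu_off _ v (hso _) hvo]
        exact hobs (emb k) v hv hvo hvp hvp')
    hdomH
  rw [hSB] at h
  exact h

end StarSet

end Summit.CriticalPhenomena.PercolationContinuityZ3.Theorems

end
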